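import Mathlib
import HarnessLib

/-!
# Venture HSemireg — arithmetic kernel of the cell's THEOREM GRID: the Eisenstein norm form never represents twice a square

HONEST FRAMING. Lean leaf for the computation cell `pub-hsemireg` (target seat t-5 gen 9, note
`run/shared/lean/pub/pub-hsemireg/target-g6/GRID-BARRIER-t5g9.md` §5, 2026-08-23). THEOREM GRID there says: a
box-product («secant-type») object `Φ(F₁ ⊠ F₂)` on the diagonal CM sixfold `E_ω⁶` with polarisation weights `c` can
have a class-exact Weil-alive twisted Chern character only if `∏ c_a` is a norm from `K = ℚ(ω)`; on the cell's
deciding datum `R1 = (1,1,1,1,1,2)` the product is `2`, and the norm equation it would need is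
`N(λ) = 2 · N(r) · s²`, i.e. `x² − xy + y² = 2·(rational square)`. THIS FILE proves — fully, no hypotheses —
only that elementary arithmetic statement (the prime `2` is inert in `ℤ[ω]`, a corollary of
[IrelandRosen1990, Ch. 9 §1, Prop. 9.1.4] «if p ≡ 2 (mod 3) then p is prime in ℤ[ω]», here re-proved by a
self-contained descent at `2`). It constructs no object, computes no semiregularity map, and says nothing about
HC, HC_CM or HC_AV; the geometric part of THEOREM GRID is NOT formalised here.

`a² − ab + b² = 2q²` has only the trivial integral solution; equivalently `x² − xy + y² = 2` has no rational
solution, i.e. `2` is not a norm from `ℚ(ω)` (`ω² + ω + 1 = 0`), even up to rational squares: the prime `2` is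
inert in `ℤ[ω]`. Proof: infinite descent at the prime `2` — if `a² − ab + b²` is even then `a` and `b` are both
even, hence `4 ∣ 2q²`, hence `q` is even, and `(a/2, b/2, q/2)` is a smaller solution. [folklore]

-/

namespace Summit.Ventures.HSemireg

/-- Parity step of the descent: if `a² − ab + b² = 2q²` over `ℤ` then `a`, `b` and `q` are all even
(corollary of `2` being prime in `ℤ[ω]`). [cite: IrelandRosen1990, Ch. 9 §1 Prop. 9.1.4] -/
theorem eisensteinNorm_two_descent {a b q : ℤ} (h : a ^ 2 - a * b + b ^ 2 = 2 * q ^ 2) :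
    2 ∣ a ∧ 2 ∣ b ∧ 2 ∣ q := by
  have h2q : Even (2 * q ^ 2) := ⟨q ^ 2, by ring⟩
  rcases Int.even_or_odd a with ha | ha <;> rcases Int.even_or_odd b with hb | hb
  · -- both even: then q² is even
    obtain ⟨k, rfl⟩ := ha
    obtain ⟨m, rfl⟩ := hb
    have hq2 : q ^ 2 = 2 * (k ^ 2 - k * m + m ^ 2) := by linarith
    have hqe : Even (q ^ 2) := ⟨k ^ 2 - k * m + m ^ 2, by rw [hq2]; ring⟩
    have hq : Even q := (Int.even_pow.mp hqe).1
    exact ⟨⟨k, by ring⟩, ⟨m, by ring⟩, even_iff_two_dvd.mp hq⟩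
  · exfalso
    have : Even (a ^ 2 - a * b + b ^ 2) := by rw [h]; exact h2q
    simp [Int.even_sub, Int.even_add, Int.even_pow, ha, Int.not_even_iff_odd.mpr hb] at this
  · exfalso
    have : Even (a ^ 2 - a * b + b ^ 2) := by rw [h]; exact h2q
    simp [Int.even_sub, Int.even_add, Int.even_pow, hb, Int.not_even_iff_odd.mpr ha] at this
  · exfalso
    have : Even (a ^ 2 - a * b + b ^ 2) := by rw [h]; exact h2q
    simp [Int.even_sub, Int.even_add, Int.even_mul, Int.even_pow, Int.not_even_iff_odd.mpr ha,
      Int.not_even_iff_odd.mpr hb] at this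

/-- **The Eisenstein norm form does not represent twice a square**: the only integral solution of
`a² − ab + b² = 2q²` is `a = b = q = 0` (descent at the inert prime `2` of `ℤ[ω]`). [cite: IrelandRosen1990, Ch. 9 §1 Prop. 9.1.4] -/
theorem eisensteinNorm_ne_two_mul_sq (a b q : ℤ) (h : a ^ 2 - a * b + b ^ 2 = 2 * q ^ 2) :
    a = 0 ∧ b = 0 ∧ q = 0 := by
  -- strong induction on the size `|a| + |b| + |q|`
  suffices H : ∀ n : ℕ, ∀ a b q : ℤ, a.natAbs + b.natAbs + q.natAbs = n →
      a ^ 2 - a * b + b ^ 2 = 2 * q ^ 2 → a = 0 ∧ b = 0 ∧ q = 0 from H _ a b q rfl h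
  intro n
  induction n using Nat.strong_induction_on with
  | _ n ih =>
    intro a b q hn hab
    by_cases hzero : a = 0 ∧ b = 0 ∧ q = 0
    · exact hzero
    · exfalso
      obtain ⟨⟨a', rfl⟩, ⟨b', rfl⟩, ⟨q', rfl⟩⟩ := eisensteinNorm_two_descent hab
      have hab' : a' ^ 2 - a' * b' + b' ^ 2 = 2 * q' ^ 2 := by linarith
      have hlt : a'.natAbs + b'.natAbs + q'.natAbs < n := by
        have hne : ¬ (a' = 0 ∧ b' = 0 ∧ q' = 0) := by
          rintro ⟨rfl, rfl, rfl⟩; exact hzero ⟨by simp, by simp, by simp⟩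
        rw [← hn, Int.natAbs_mul, Int.natAbs_mul, Int.natAbs_mul]
        simp only [Int.reduceAbs]
        omega
      obtain ⟨rfl, rfl, rfl⟩ := ih _ hlt a' b' q' rfl hab'
      exact hzero ⟨by simp, by simp, by simp⟩

/-- **`2` is not a norm from `ℚ(ω)`, not even up to squares**: `x² − xy + y² = 2r²` over `ℚ` forces
`x = y = r = 0` — the norm equation THEOREM GRID (iii) needs on R1 has no solution. [cite: IrelandRosen1990, Ch. 9 §1 Prop. 9.1.4] -/
theorem eisensteinNorm_ne_two_mul_sq_rat (x y r : ℚ) (h : x ^ 2 - x * y + y ^ 2 = 2 * r ^ 2) :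
    x = 0 ∧ y = 0 ∧ r = 0 := by
  -- clear denominators with d = x.den * y.den * r.den
  set d : ℤ := (x.den : ℤ) * y.den * r.den with hd
  have hdpos : (0 : ℚ) < d := by
    have : 0 < d := by
      have h1 := x.den_pos; have h2 := y.den_pos; have h3 := r.den_pos
      positivity
    exact_mod_cast this
  have hd0 : (d : ℚ) ≠ 0 := ne_of_gt hdpos
  -- integers A, B, Q with x*d = A etc.
  have hx : x * d = (x.num * y.den * r.den : ℤ) := by
    have := Rat.mul_den_eq_num x
    push_cast [hd]
    calc x * ((x.den : ℚ) * y.den * r.den) = (x * x.den) * y.den * r.den := by ring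
      _ = x.num * y.den * r.den := by rw [this]
  have hy : y * d = (y.num * x.den * r.den : ℤ) := by
    have := Rat.mul_den_eq_num y
    push_cast [hd]
    calc y * ((x.den : ℚ) * y.den * r.den) = (y * y.den) * x.den * r.den := by ring
      _ = y.num * x.den * r.den := by rw [this]
  have hr : r * d = (r.num * x.den * y.den : ℤ) := by
    have := Rat.mul_den_eq_num r
    push_cast [hd]
    calc r * ((x.den : ℚ) * y.den * r.den) = (r * r.den) * x.den * y.den := by ring
      _ = r.num * x.den * y.den := by rw [this]
  set A : ℤ := x.num * y.den * r.den
  set B : ℤ := y.num * x.den * r.den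
  set Q : ℤ := r.num * x.den * y.den
  have hABQ : ((A : ℚ)) ^ 2 - (A : ℚ) * B + (B : ℚ) ^ 2 = 2 * (Q : ℚ) ^ 2 := by
    rw [← hx, ← hy, ← hr]
    have : (x * d) ^ 2 - (x * d) * (y * d) + (y * d) ^ 2 = (x ^ 2 - x * y + y ^ 2) * d ^ 2 := by ring
    rw [this, h]; ring
  have hint : A ^ 2 - A * B + B ^ 2 = 2 * Q ^ 2 := by exact_mod_cast hABQ
  obtain ⟨hA, hB, hQ⟩ := eisensteinNorm_ne_two_mul_sq A B Q hint
  refine ⟨?_, ?_, ?_⟩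
  · have : x * d = 0 := by rw [hx, hA]; simp
    rcases mul_eq_zero.mp this with h0 | h0
    · exact h0
    · exact absurd h0 hd0
  · have : y * d = 0 := by rw [hy, hB]; simp
    rcases mul_eq_zero.mp this with h0 | h0
    · exact h0
    · exact absurd h0 hd0
  · have : r * d = 0 := by rw [hr, hQ]; simp
    rcases mul_eq_zero.mp this with h0 | h0
    · exact h0
    · exact absurd h0 hd0

/-- In particular `x² − xy + y² ≠ 2` for all rational `x, y`: the prime `2` (inert in `ℤ[ω]`) is not a norm
from `ℚ(ω)`. [cite: IrelandRosen1990, Ch. 9 §1 Prop. 9.1.4] -/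
theorem eisensteinNorm_ne_two (x y : ℚ) : x ^ 2 - x * y + y ^ 2 ≠ 2 := by
  intro h
  have := eisensteinNorm_ne_two_mul_sq_rat x y 1 (by rw [h]; ring)
  exact one_ne_zero this.2.2

end Summit.Ventures.HSemireg
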